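import Mathlib
import HarnessLib
import Summits.ValiantsHypothesis.ValiantsHypothesis.Theorems.MonotoneRestorationOrbitRestorationLinearVolumeQPVHStrengthHom
import Summits.ValiantsHypothesis.ValiantsHypothesis.Theorems.MonotoneRestorationOrbitRestorationQPHomSpan
import Summits.ValiantsHypothesis.ValiantsHypothesis.Theorems.MonotoneRestorationMonotoneRestorationQPSymmetricLB
import Literature.ModelTheory.FiniteModelTheory.DawarWilsenach2025Thm72
import Literature.Computability.AlgebraicComplexity.DawarWilsenach2025Proofs
import Literature.Computability.AlgebraicComplexity.StandardFamiliesProofs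

/-!
# R1 (`OrbitRestorationLinearVolumeQP`, stmt-ValiantsHypothesis-18294) IMPLIES VALIANT'S HYPOTHESIS —
# unconditionally

Route MonotoneRestoration.  The aside R1 — every `VP` family that is, level by level, a polynomial-dimension
combination of homomorphism polynomials of LINEAR-VOLUME bipartite patterns has square-symmetric circuits of
quasi-polynomial orbit size — was filed as the route's "VH-free positive re-target", outside the cone of `closes`.
This file proves

* `valiantsHypothesis_of_orbitRestorationLinearVolumeQP : OrbitRestorationLinearVolumeQP → ValiantsHypothesis`,

with NO extra hypothesis.  The separating linear-volume pattern family that `…VHStrengthHom.lean` asked for comes for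
free from two PROVED theorems of the tree: Dawar–Wilsenach 2025 Thm 7.2
(`CFIMatching.DawarWilsenach2025_thm72_family`: for every `k`, two `≡^{C^k}`-equivalent bipartite graphs on
`m ≤ c k + c` vertices with different numbers of perfect matchings, hence different PERMANENT values at their `0/1`
adjacency matrices, `eval_perPoly_adj_ne_of_card_perfectMatchings_ne`) and the spanning half of the hom-basis theorem
(`HomSpan.mem_span_homPoly_of_matrixSymmetric`: the matrix-symmetric `per_m`, of degree `m`, is a combination of
homomorphism polynomials of bipartite patterns with `≤ m` rows, `≤ m` columns and `≤ m` edges).  A linear combination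
that separates two points has a separating generator (`exists_generator_eval_ne`), so at every Dawar–Wilsenach order
`m` SOME pattern with `≤ m + m` vertices and `≤ m` edges has different hom counts on the `≡^{C^k}` pair, `k > (m-c)/c`
— a polylog-separating (indeed linearly separating) LINEAR-VOLUME pattern family (`exists_pattern_separating`; one
pattern per order, selected as in the tree's proof of Dawar–Wilsenach Thm 7.1).  Its hom polynomials are a `VNP` family
(`HomPolyVNP.isVNPFamily_homPoly`), and `valiantsHypothesis_of_orbitRestorationLinearVolumeQP_of_separating` finishes:
under `VP = VNP` the family is in R1's class with one pattern per level, R1 gives quasi-polynomial orbits, the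
orbit-form Dawar–Wilsenach pipeline forbids them.

Reading for the planners: R1 is a SPECIAL CASE of the crux `OrbitRestorationQP` (same conclusion, hypothesis class
restricted to linear-volume hom combinations) and still decides the summit; it could serve as a binder of `closes`
in place of (and weaker than) `OrbitRestorationQP`.  Honest framing: a placement result — R1 itself
(`stub_lvNarrowSpan`, Dwivedi–Pago–Seppelt Outlook Q3 at quasi-polynomial scale), the crux and VP ≠ VNP stay open.
-/

noncomputable section

-- `Summit.ValiantsHypothesis.ValiantsHypothesis.…` is the tree's single-conjunct layout (Sub = Summit).
set_option linter.dupNamespace false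

namespace Summit.ValiantsHypothesis.ValiantsHypothesis.Theorems

namespace OrbitRestorationLinearVolumeQPVHStrength

open MvPolynomial
open Summit.ValiantsHypothesis.ValiantsHypothesis.Theses.MonotoneRestoration
open Literature.Computability.AlgebraicComplexity
open Literature.ModelTheory.FiniteModelTheory

/-- The permanent polynomial is matrix-symmetric (invariant under independent row and column permutations).
[folklore] -/
theorem rename_perm_perPoly (n : ℕ) (σ τ : Equiv.Perm (Fin n)) :
    MvPolynomial.rename (fun p : Fin n × Fin n => (σ p.1, τ p.2)) (perPoly (Fin n) ℂ) =
      perPoly (Fin n) ℂ := by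
  -- adapted from the deciding theorem `closes` of Theses/MonotoneRestoration.lean
  have h1 : MvPolynomial.rename (fun p : Fin n × Fin n => (σ p.1, τ p.2)) (perPoly (Fin n) ℂ) =
      ((Matrix.mvPolynomialX (Fin n) (Fin n) ℂ).submatrix σ τ).permanent := by
    simp only [perPoly, Matrix.permanent, map_sum, map_prod, Matrix.mvPolynomialX_apply,
      MvPolynomial.rename_X, Matrix.submatrix_apply]
  rw [h1]
  have h2 : ((Matrix.mvPolynomialX (Fin n) (Fin n) ℂ).submatrix (σ : Fin n → Fin n) (τ : Fin n → Fin n)) =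
      (((Matrix.mvPolynomialX (Fin n) (Fin n) ℂ).submatrix id (τ : Fin n → Fin n)).submatrix
        (σ : Fin n → Fin n) id) := by
    ext i j; simp
  rw [h2, Matrix.permanent_permute_cols, Matrix.permanent_permute_rows]
  rfl

/-- Evaluations at two points that agree on a generating set agree on the span (evaluation is linear).
[folklore] -/
theorem eval_eq_of_mem_span {ι : Type*} {S : Set (MvPolynomial ι ℂ)} {p : MvPolynomial ι ℂ}
    (hp : p ∈ Submodule.span ℂ S) (x y : ι → ℂ) (h : ∀ q ∈ S, eval x q = eval y q) :
    eval x p = eval y p := by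
  induction hp using Submodule.span_induction with
  | mem q hq => exact h q hq
  | zero => simp
  | add q r _ _ hq hr => rw [map_add, map_add, hq, hr]
  | smul a q _ hq => rw [smul_eq_C_mul, map_mul, map_mul, eval_C, eval_C, hq]

/-- A member of a linear span that takes different values at two points has a GENERATOR taking different
values there. [folklore] -/
theorem exists_generator_eval_ne {ι : Type*} {S : Set (MvPolynomial ι ℂ)} {p : MvPolynomial ι ℂ}
    (hp : p ∈ Submodule.span ℂ S) (x y : ι → ℂ) (hne : eval x p ≠ eval y p) :
    ∃ q ∈ S, eval x q ≠ eval y q := by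
  by_contra h
  push Not at h
  exact hne (eval_eq_of_mem_span hp x y h)

/-- The `0/1` adjacency matrix as an indicator function (the evaluation point used by the route's negative
files) is the `if`-matrix used by the Dawar–Wilsenach files. [folklore] -/
theorem indicator_adj_eq {m : ℕ} (X : SimpleGraph (Fin m)) [DecidableRel X.Adj] :
    Set.indicator {ij : Fin m × Fin m | X.Adj ij.1 ij.2} (1 : Fin m × Fin m → ℂ) =
      fun ij => if X.Adj ij.1 ij.2 then (1 : ℂ) else 0 := by
  funext ij
  by_cases h : X.Adj ij.1 ij.2 <;> simp [h]

/-- **A separating linear-volume pattern at every Dawar–Wilsenach order.**  If two graphs on `Fin m` get different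
PERMANENT values at their `0/1` adjacency matrices, then some bipartite multigraph pattern with `≤ m` rows, `≤ m`
columns and `≤ m` edges has different homomorphism-polynomial values there — the permanent is a combination of such
homomorphism polynomials (`HomSpan.mem_span_homPoly_of_matrixSymmetric`, degree `m` by `totalDegree_perPoly_holds`).
[cite: DwivediPagoSeppelt2026, §4 (every matrix-symmetric polynomial is a combination of hom polynomials of volume ≤ n)] -/
theorem exists_pattern_separating (m : ℕ) (X Y : SimpleGraph (Fin m))
    (hne : eval (Set.indicator {ij : Fin m × Fin m | X.Adj ij.1 ij.2} 1) (perPoly (Fin m) ℂ) ≠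
      eval (Set.indicator {ij : Fin m × Fin m | Y.Adj ij.1 ij.2} 1) (perPoly (Fin m) ℂ)) :
    ∃ (a b : ℕ) (E : Multiset (Fin a × Fin b)), a ≤ m ∧ b ≤ m ∧ Multiset.card E ≤ m ∧
      eval (Set.indicator {ij : Fin m × Fin m | X.Adj ij.1 ij.2} 1) (homPoly E m ℂ) ≠
        eval (Set.indicator {ij : Fin m × Fin m | Y.Adj ij.1 ij.2} 1) (homPoly E m ℂ) := by
  have hspan := HomSpan.mem_span_homPoly_of_matrixSymmetric (perPoly (Fin m) ℂ) (rename_perm_perPoly m)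
  have hdeg : (perPoly (Fin m) ℂ).totalDegree = m := by
    rw [totalDegree_perPoly_holds, Fintype.card_fin]
  obtain ⟨q, ⟨a, b, E, ha, hb, hE, rfl⟩, hq⟩ := exists_generator_eval_ne hspan _ _ hne
  exact ⟨a, b, E, hdeg ▸ ha, hdeg ▸ hb, hdeg ▸ hE, hq⟩

/-- **R1 ⇒ VP ≠ VNP.**  `OrbitRestorationLinearVolumeQP` — square-symmetric circuits of quasi-polynomial ORBIT size
for every `VP` family that is, level by level, a polynomial-dimension combination of homomorphism polynomials of
linear-volume bipartite patterns — implies Valiant's hypothesis over `ℂ`.  The separating family: at each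
Dawar–Wilsenach order `m` (Thm 7.2: `≡^{C^k}`-equivalent bipartite graphs, `m ≤ c k + c`, different permanents) a
pattern with `≤ m` rows/columns/edges separating the pair (`exists_pattern_separating`); it is linearly, hence
polylog-, separating, of linear volume and polynomial size, so `VNP` (`HomPolyVNP.isVNPFamily_homPoly`), and
`valiantsHypothesis_of_orbitRestorationLinearVolumeQP_of_separating` applies.
[cite: DawarWilsenach2025, Thm 7.2, Thm 5.1, §6, §7.1; DwivediPagoSeppelt2026, Outlook Q3] -/
theorem valiantsHypothesis_of_orbitRestorationLinearVolumeQP :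
    OrbitRestorationLinearVolumeQP → ValiantsHypothesis := by
  intro hR1
  classical
  obtain ⟨c, hc⟩ := CFIMatching.DawarWilsenach2025_thm72_family
  choose m hm X Y hXb hYb hXY hpm using hc
  -- the permanent separates each pair (characteristic `0`)
  have hne : ∀ k, eval (Set.indicator {ij : Fin (m k) × Fin (m k) | (X k).Adj ij.1 ij.2} 1)
      (perPoly (Fin (m k)) ℂ) ≠
      eval (Set.indicator {ij : Fin (m k) × Fin (m k) | (Y k).Adj ij.1 ij.2} 1) (perPoly (Fin (m k)) ℂ) := by
    intro k
    obtain ⟨s, t, hs, hst⟩ := hXb k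
    obtain ⟨s', t', hs', hst'⟩ := hYb k
    rw [indicator_adj_eq, indicator_adj_eq]
    exact eval_perPoly_adj_ne_of_card_perfectMatchings_ne hs hst hs' hst' ℂ (hpm k)
  -- hence the pair is not isomorphic, so `k < m k`
  have hkm : ∀ k, k < m k := by
    intro k
    by_contra hk
    have hk' : m k ≤ k := not_lt.mp hk
    apply hpm k
    rcases Nat.eq_zero_or_pos (m k) with h0 | hpos
    · have hXYeq : X k = Y k := by
        ext u v
        exact absurd u.isLt (by omega)
      rw [hXYeq]
    · rcases Nat.eq_zero_or_pos k with hk0 | hkpos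
      · omega
      · obtain ⟨e⟩ := (hXY k).nonempty_iso hkpos (by simpa using hk')
        exact Literature.Probability.LatticeModels.card_perfectMatchings_eq_of_iso e
  -- a separating linear-volume pattern at every order `m k`
  choose a b E ha hb hE hsepk using fun k => exists_pattern_separating (m k) (X k) (Y k) (hne k)
  -- select one index per order, as in the tree's proof of Dawar–Wilsenach Thm 7.1
  let ksel : ℕ → ℕ := fun n => if h : ∃ k, m k = n then h.choose else 0
  have hksel : ∀ k, m (ksel (m k)) = m k := by
    intro k
    have h : ∃ k', m k' = m k := ⟨k, rfl⟩
    simp only [ksel, dif_pos h]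
    exact h.choose_spec
  have hm0 : m 0 ≤ c := by simpa using hm 0
  -- size bounds at every matrix order `n` (orders outside the range of `m` carry the pattern of index `0`)
  have hsize : ∀ n, a (ksel n) ≤ n + c ∧ b (ksel n) ≤ n + c ∧ Multiset.card (E (ksel n)) ≤ n + c := by
    intro n
    by_cases h : ∃ k, m k = n
    · have hk : m (ksel n) = n := by
        simp only [ksel, dif_pos h]
        exact h.choose_spec
      have h1 := ha (ksel n); have h2 := hb (ksel n); have h3 := hE (ksel n)
      rw [hk] at h1 h2 h3
      exact ⟨by omega, by omega, by omega⟩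
    · have hk0 : ksel n = 0 := by simp only [ksel, dif_neg h]
      rw [hk0]
      have h1 := ha 0; have h2 := hb 0; have h3 := hE 0
      exact ⟨by omega, by omega, by omega⟩
  refine valiantsHypothesis_of_orbitRestorationLinearVolumeQP_of_separating
    (fun n => a (ksel n)) (fun n => b (ksel n)) (fun n => E (ksel n)) (2 * c + 2)
    (fun n => ?_) (fun n => ?_) (fun c' N => ?_) hR1
  · -- volume `≤ (2c + 2)(n + 1)`
    obtain ⟨h1, h2, -⟩ := hsize n
    nlinarith
  · -- edges `≤ n + c ≤ (n + 2)^(2c + 2)`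
    obtain ⟨-, -, h3⟩ := hsize n
    refine h3.trans ?_
    have h4 : c ≤ 2 ^ c := Nat.lt_two_pow_self.le
    have h5 : 2 ^ c ≤ (n + 2) ^ c := Nat.pow_le_pow_left (by omega) _
    calc n + c ≤ (n + 2) * (n + 2) ^ c := by nlinarith [Nat.one_le_pow c (n + 2) (by omega)]
      _ = (n + 2) ^ (c + 1) := by ring
      _ ≤ (n + 2) ^ (2 * c + 2) := Nat.pow_le_pow_right (by omega) (by omega)
  · -- polylog (indeed linear) separation at a large Dawar–Wilsenach order
    obtain ⟨k₁, hk₁⟩ := symmetricLB_logPow_lt c' (δ := 1 / (2 * (c : ℝ) + 2)) (by positivity)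
    obtain ⟨M₀, hM₀N, hM₀K⟩ : ∃ M₀ : ℕ, N ≤ M₀ ∧ 2 ^ k₁ ≤ M₀ :=
      ⟨max N (2 ^ k₁), le_max_left _ _, le_max_right _ _⟩
    obtain ⟨k₀, hk₀_def⟩ : ∃ k₀ : ℕ, k₀ = M₀ + c + 1 := ⟨_, rfl⟩
    obtain ⟨k', hk'_def⟩ : ∃ k' : ℕ, k' = ksel (m k₀) := ⟨_, rfl⟩
    have hmk' : m k' = m k₀ := by rw [hk'_def]; exact hksel k₀
    have hk₀m : k₀ < m k₀ := hkm k₀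
    have hsel : ksel (m k') = k' := by rw [hmk', hk'_def]
    have hk'1 : 1 ≤ k' := by
      by_contra h0
      have hz : k' = 0 := by omega
      have : m k' ≤ c := by rw [hz]; exact hm0
      omega
    refine ⟨m k', ?_, X k', Y k', ?_, ?_⟩
    · omega
    · refine (hXY k').mono ?_
      -- `(log₂ (m k') + c')^c' < m k' / (2c+2) ≤ k'`
      have h2 : 2 ^ k₁ ≤ m k' := hM₀K.trans (by omega)
      have hlt := hk₁ (m k') h2
      have hmle : ((m k' : ℕ) : ℝ) ≤ (c : ℝ) * (k' : ℝ) + (c : ℝ) := by exact_mod_cast hm k'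
      have hk1r : (1 : ℝ) ≤ (k' : ℝ) := by exact_mod_cast hk'1
      have hc0 : (0 : ℝ) ≤ (c : ℝ) := Nat.cast_nonneg c
      have h3 : 1 / (2 * (c : ℝ) + 2) * ((m k' : ℕ) : ℝ) ≤ (k' : ℝ) := by
        rw [one_div, inv_mul_le_iff₀ (by positivity)]
        nlinarith [mul_nonneg hc0 (sub_nonneg.mpr hk1r)]
      have h4 : ((Nat.log 2 (m k') + c') ^ c' : ℝ) < (k' : ℝ) := hlt.trans_le h3
      have h5 : (((Nat.log 2 (m k') + c') ^ c' : ℕ) : ℝ) < (k' : ℝ) := by push_cast; exact h4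
      exact (by exact_mod_cast h5 : (Nat.log 2 (m k') + c') ^ c' < k').le
    · show eval _ (homPoly (E (ksel (m k'))) (m k') ℂ) ≠ eval _ (homPoly (E (ksel (m k'))) (m k') ℂ)
      rw [hsel]
      exact hsepk k'

end OrbitRestorationLinearVolumeQPVHStrength

end Summit.ValiantsHypothesis.ValiantsHypothesis.Theorems

end
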